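import Summits.Ventures.LatticeQCDFlow.Exactness.IMHColdStartMSE
import HarnessLib

/-!
# The cold start, second order: the measured autocovariance of a cold-started flow-MCMC run carries a spurious
# mode of rate exactly `1 − 1/w(x₀)` — the exact bias of the lag-`u` estimator

HONEST FRAMING: exact (Metropolis-corrected) sampling algorithms for lattice gauge theory;
figures of merit are autocorrelation/cost numbers at stated couplings and volumes; no
continuum-physics claim.

Venture `LatticeQCDFlow` (cell pub-lqcd), topic `Exactness`; FANOUT row 30 (lean-1, GEN-32).  NEW WORK of the
cell, general state space.  Setting of `IMHColdStartTwoTime` / `IMHColdStartMSE` (this generation): `K = indepMH q w`,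
`w` normalised, maximal at `x₀`, `r = 1 − 1/w(x₀)`, `f` bounded measurable, `f̄ = f − π f`, `δ = f(x₀) − π f`,
`γ_u = ∫ f̄·(K^u f̄) dπ` the equilibrium autocovariance at lag `u`, `V = γ_0`, `S_M = Σ_{s<M} r^s`.  The integrated
autocorrelation time — the venture's figure of merit — is estimated from the lag products
`Ĉ_u = (1/M)Σ_{s<M} f̄(X_s) f̄(X_{s+u})` of a run (`M = N − u` windows; here centred at the true mean `π f`).  From the
cold start their expectation is known EXACTLY:

* §1 **`imh_chain_lagProduct_mode`** — `E_{x₀}[f̄(X_s) f̄(X_{s+u})] = (1 − r^s)·γ_u + r^{s+u}·δ²`.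
* §2 **`imh_chain_lagProductSum_mode`** — `Σ_{s<M} E_{x₀}[f̄(X_s)f̄(X_{s+u})] = M·γ_u + (r^u δ² − γ_u)·S_M`, i.e.
  (**`imh_chain_autocovEstimate_bias_mode`**, `M ≥ 1`) THE EXPECTED MEASURED AUTOCOVARIANCE IS
  `E_{x₀} Ĉ_u = γ_u + (r^u·δ² − γ_u)·S_M/M`: the cold start REPLACES a fraction `S_M/M` of the true lag-`u`
  autocovariance by the SPURIOUS GEOMETRIC MODE `δ²·r^u` — decay rate exactly `1 − 1/w(x₀) = 1 − A(x₀)`, the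
  uniform rate of the sampler (GEN-28), amplitude `δ²`, weight `S_M/M ∈ [1/(1 + M/w(x₀)), min(1, w(x₀)/M)]`
  (**`imh_chain_autocovEstimate_bias_two_sided`**).
* §3 signs, from the tree's `0 ≤ γ_u ≤ r^u·V`: **`imh_chain_autocovEstimate_bias_nonneg_of_var_le`** — if
  `Var_π f ≤ δ²` (an observable extremal at the cold configuration, as the plaquette is) the measured
  autocovariance OVERESTIMATES `γ_u` at EVERY lag: a cold-started run looks slower than the sampler is;
  **`imh_chain_autocovEstimate_bias_nonpos_of_delta_eq_zero`** — if `f(x₀) = π f` it UNDERESTIMATES `γ_u` at every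
  lag, by exactly the factor `1 − S_M/M`.
* §4 **`imh_chain_varianceEstimate_mode`** — lag `0`: `E_{x₀}[(1/M)Σ_{s<M} f̄(X_s)²] = V + (δ² − V)·S_M/M`.

Reading (value-free): a cold-started exact gauge sampler's printed autocorrelation function is the equilibrium one
plus a spurious component decaying at exactly the cold escape rate `A = Z/(c^{#B}M^k)`, with relative weight
`≈ 1/(M·A)`; discarding `b` steps first multiplies it by `(1 − A)^b` (GEN-31 `IMHColdStartDiscard`).  NOT CLAIMED:
estimators centred at the empirical mean; the windowed `τ_int` estimator itself (a ratio); fluctuations of `Ĉ_u`.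

No `sorry`, no new definitions, nothing cited as a fact; general measurable space with measurable singletons.
-/

noncomputable section

namespace Summit.Ventures.LatticeQCDFlow.Exactness

open MeasureTheory ProbabilityTheory Function Finset
open scoped ENNReal
open Summit.Ventures.LatticeQCDFlow.Scoring

variable {Ω : Type*} [MeasurableSpace Ω] [MeasurableSingletonClass Ω]
variable {q : Measure Ω} [IsProbabilityMeasure q] {w : Ω → ℝ}

/-! ## §1 The lag product at `(s, s+u)` -/

/-- **`E_{x₀}[f̄(X_s) f̄(X_{s+u})] = (1 − r^s)·γ_u + r^{s+u}·δ²`**, `f̄ = f − π f`. [ours] -/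
theorem imh_chain_lagProduct_mode [Fact (Measurable w)] (hw0 : ∀ y, 0 < w y) {x₀ : Ω} (hmax : ∀ y, w y ≤ w x₀)
    [IsProbabilityMeasure (q.withDensity fun y => ENNReal.ofReal (w y))]
    {f : Ω → ℝ} (hf : Measurable f) {C : ℝ} (hC : ∀ x, |f x| ≤ C) (s u : ℕ) :
    ∫ x, (f (x s) - ∫ z, f z ∂(q.withDensity fun y => ENNReal.ofReal (w y))) *
        (f (x (s + u)) - ∫ z, f z ∂(q.withDensity fun y => ENNReal.ofReal (w y)))
        ∂(Kernel.trajMeasure (X := fun _ : ℕ => Ω) (Measure.dirac x₀)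
          (fun n : ℕ => (indepMH q w).comap (fun h : (i : ↥(Finset.Iic n)) → Ω => h ⟨n, Finset.mem_Iic.2 le_rfl⟩)
            (measurable_pi_apply _))) =
      (1 - (1 - (w x₀)⁻¹) ^ s) *
          autocov (indepMH q w) (q.withDensity fun y => ENNReal.ofReal (w y))
            (fun x => f x - ∫ z, f z ∂(q.withDensity fun y => ENNReal.ofReal (w y))) u +
        (1 - (w x₀)⁻¹) ^ (s + u) * (f x₀ - ∫ z, f z ∂(q.withDensity fun y => ENNReal.ofReal (w y))) ^ 2 := by
  rw [imh_chain_pair_mode hw0 hmax hf hC s (s + u), min_eq_left (Nat.le_add_right s u),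
    max_eq_right (Nat.le_add_right s u), Nat.dist_eq_sub_of_le (Nat.le_add_right s u), Nat.add_sub_cancel_left]

/-! ## §2 The expected measured autocovariance at lag `u` -/

/-- **`Σ_{s<M} E_{x₀}[f̄(X_s)f̄(X_{s+u})] = M·γ_u + (r^u·δ² − γ_u)·S_M`**, `S_M = Σ_{s<M} r^s`. [ours] -/
theorem imh_chain_lagProductSum_mode [Fact (Measurable w)] (hw0 : ∀ y, 0 < w y) {x₀ : Ω} (hmax : ∀ y, w y ≤ w x₀)
    [IsProbabilityMeasure (q.withDensity fun y => ENNReal.ofReal (w y))]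
    {f : Ω → ℝ} (hf : Measurable f) {C : ℝ} (hC : ∀ x, |f x| ≤ C) (M u : ℕ) :
    ∑ s ∈ Finset.range M, ∫ x, (f (x s) - ∫ z, f z ∂(q.withDensity fun y => ENNReal.ofReal (w y))) *
        (f (x (s + u)) - ∫ z, f z ∂(q.withDensity fun y => ENNReal.ofReal (w y)))
        ∂(Kernel.trajMeasure (X := fun _ : ℕ => Ω) (Measure.dirac x₀)
          (fun n : ℕ => (indepMH q w).comap (fun h : (i : ↥(Finset.Iic n)) → Ω => h ⟨n, Finset.mem_Iic.2 le_rfl⟩)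
            (measurable_pi_apply _))) =
      M * autocov (indepMH q w) (q.withDensity fun y => ENNReal.ofReal (w y))
            (fun x => f x - ∫ z, f z ∂(q.withDensity fun y => ENNReal.ofReal (w y))) u +
        ((1 - (w x₀)⁻¹) ^ u * (f x₀ - ∫ z, f z ∂(q.withDensity fun y => ENNReal.ofReal (w y))) ^ 2 -
            autocov (indepMH q w) (q.withDensity fun y => ENNReal.ofReal (w y))
              (fun x => f x - ∫ z, f z ∂(q.withDensity fun y => ENNReal.ofReal (w y))) u) *
          ∑ s ∈ Finset.range M, (1 - (w x₀)⁻¹) ^ s := by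
  simp only [imh_chain_lagProduct_mode hw0 hmax hf hC]
  have : ∀ s ∈ Finset.range M,
      (1 - (1 - (w x₀)⁻¹) ^ s) *
          autocov (indepMH q w) (q.withDensity fun y => ENNReal.ofReal (w y))
            (fun x => f x - ∫ z, f z ∂(q.withDensity fun y => ENNReal.ofReal (w y))) u +
        (1 - (w x₀)⁻¹) ^ (s + u) * (f x₀ - ∫ z, f z ∂(q.withDensity fun y => ENNReal.ofReal (w y))) ^ 2 =
      autocov (indepMH q w) (q.withDensity fun y => ENNReal.ofReal (w y))
            (fun x => f x - ∫ z, f z ∂(q.withDensity fun y => ENNReal.ofReal (w y))) u +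
        ((1 - (w x₀)⁻¹) ^ u * (f x₀ - ∫ z, f z ∂(q.withDensity fun y => ENNReal.ofReal (w y))) ^ 2 -
            autocov (indepMH q w) (q.withDensity fun y => ENNReal.ofReal (w y))
              (fun x => f x - ∫ z, f z ∂(q.withDensity fun y => ENNReal.ofReal (w y))) u) *
          (1 - (w x₀)⁻¹) ^ s := fun s _ => by rw [pow_add]; ring
  rw [Finset.sum_congr rfl this, Finset.sum_add_distrib, Finset.sum_const, Finset.card_range, nsmul_eq_mul,
    ← Finset.mul_sum]

/-- **THE EXACT BIAS OF THE MEASURED AUTOCOVARIANCE**: for `M ≥ 1` windows,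
`(1/M)Σ_{s<M} E_{x₀}[f̄(X_s)f̄(X_{s+u})] − γ_u = (r^u·δ² − γ_u)·S_M/M` — a fraction `S_M/M` of the true lag-`u`
autocovariance is replaced by the spurious geometric mode `δ²·r^u`. [ours] -/
theorem imh_chain_autocovEstimate_bias_mode [Fact (Measurable w)] (hw0 : ∀ y, 0 < w y) {x₀ : Ω}
    (hmax : ∀ y, w y ≤ w x₀) [IsProbabilityMeasure (q.withDensity fun y => ENNReal.ofReal (w y))]
    {f : Ω → ℝ} (hf : Measurable f) {C : ℝ} (hC : ∀ x, |f x| ≤ C) {M : ℕ} (hM : M ≠ 0) (u : ℕ) :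
    (∑ s ∈ Finset.range M, ∫ x, (f (x s) - ∫ z, f z ∂(q.withDensity fun y => ENNReal.ofReal (w y))) *
        (f (x (s + u)) - ∫ z, f z ∂(q.withDensity fun y => ENNReal.ofReal (w y)))
        ∂(Kernel.trajMeasure (X := fun _ : ℕ => Ω) (Measure.dirac x₀)
          (fun n : ℕ => (indepMH q w).comap (fun h : (i : ↥(Finset.Iic n)) → Ω => h ⟨n, Finset.mem_Iic.2 le_rfl⟩)
            (measurable_pi_apply _)))) / M -
        autocov (indepMH q w) (q.withDensity fun y => ENNReal.ofReal (w y))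
          (fun x => f x - ∫ z, f z ∂(q.withDensity fun y => ENNReal.ofReal (w y))) u =
      ((1 - (w x₀)⁻¹) ^ u * (f x₀ - ∫ z, f z ∂(q.withDensity fun y => ENNReal.ofReal (w y))) ^ 2 -
          autocov (indepMH q w) (q.withDensity fun y => ENNReal.ofReal (w y))
            (fun x => f x - ∫ z, f z ∂(q.withDensity fun y => ENNReal.ofReal (w y))) u) *
        (∑ s ∈ Finset.range M, (1 - (w x₀)⁻¹) ^ s) / M := by
  have hMpos : (0 : ℝ) < M := by exact_mod_cast Nat.pos_of_ne_zero hM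
  rw [imh_chain_lagProductSum_mode hw0 hmax hf hC M u]
  field_simp
  ring

/-- **TWO-SIDED**: `|r^uδ² − γ_u|/(1 + M/w(x₀)) ≤ |E_{x₀} Ĉ_u − γ_u| ≤ |r^uδ² − γ_u|·min(1, w(x₀)/M)` (`M ≥ 1`): the
spurious component of the measured autocovariance decays in the run length like `w(x₀)/M`, not geometrically.
[ours] -/
theorem imh_chain_autocovEstimate_bias_two_sided [Fact (Measurable w)] (hw0 : ∀ y, 0 < w y) {x₀ : Ω}
    (hmax : ∀ y, w y ≤ w x₀) [IsProbabilityMeasure (q.withDensity fun y => ENNReal.ofReal (w y))]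
    {f : Ω → ℝ} (hf : Measurable f) {C : ℝ} (hC : ∀ x, |f x| ≤ C) {M : ℕ} (hM : M ≠ 0) (u : ℕ) :
    |(1 - (w x₀)⁻¹) ^ u * (f x₀ - ∫ z, f z ∂(q.withDensity fun y => ENNReal.ofReal (w y))) ^ 2 -
          autocov (indepMH q w) (q.withDensity fun y => ENNReal.ofReal (w y))
            (fun x => f x - ∫ z, f z ∂(q.withDensity fun y => ENNReal.ofReal (w y))) u| *
        (1 / (1 + M * (w x₀)⁻¹)) ≤
      |(∑ s ∈ Finset.range M, ∫ x, (f (x s) - ∫ z, f z ∂(q.withDensity fun y => ENNReal.ofReal (w y))) *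
          (f (x (s + u)) - ∫ z, f z ∂(q.withDensity fun y => ENNReal.ofReal (w y)))
          ∂(Kernel.trajMeasure (X := fun _ : ℕ => Ω) (Measure.dirac x₀)
            (fun n : ℕ => (indepMH q w).comap (fun h : (i : ↥(Finset.Iic n)) → Ω => h ⟨n, Finset.mem_Iic.2 le_rfl⟩)
              (measurable_pi_apply _)))) / M -
        autocov (indepMH q w) (q.withDensity fun y => ENNReal.ofReal (w y))
          (fun x => f x - ∫ z, f z ∂(q.withDensity fun y => ENNReal.ofReal (w y))) u| ∧
    |(∑ s ∈ Finset.range M, ∫ x, (f (x s) - ∫ z, f z ∂(q.withDensity fun y => ENNReal.ofReal (w y))) *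
          (f (x (s + u)) - ∫ z, f z ∂(q.withDensity fun y => ENNReal.ofReal (w y)))
          ∂(Kernel.trajMeasure (X := fun _ : ℕ => Ω) (Measure.dirac x₀)
            (fun n : ℕ => (indepMH q w).comap (fun h : (i : ↥(Finset.Iic n)) → Ω => h ⟨n, Finset.mem_Iic.2 le_rfl⟩)
              (measurable_pi_apply _)))) / M -
        autocov (indepMH q w) (q.withDensity fun y => ENNReal.ofReal (w y))
          (fun x => f x - ∫ z, f z ∂(q.withDensity fun y => ENNReal.ofReal (w y))) u| ≤
      |(1 - (w x₀)⁻¹) ^ u * (f x₀ - ∫ z, f z ∂(q.withDensity fun y => ENNReal.ofReal (w y))) ^ 2 -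
          autocov (indepMH q w) (q.withDensity fun y => ENNReal.ofReal (w y))
            (fun x => f x - ∫ z, f z ∂(q.withDensity fun y => ENNReal.ofReal (w y))) u| *
        min 1 (w x₀ / M) := by
  have hMpos : (0 : ℝ) < M := by exact_mod_cast Nat.pos_of_ne_zero hM
  have hW : 1 ≤ w x₀ := one_le_of_mode (q := q) hmax
  have hr0 : 0 ≤ 1 - (w x₀)⁻¹ := sub_nonneg.2 (inv_le_one_of_one_le₀ hW)
  have hS0 : 0 ≤ ∑ s ∈ Finset.range M, (1 - (w x₀)⁻¹) ^ s := sum_nonneg fun s _ => pow_nonneg hr0 s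
  rw [imh_chain_autocovEstimate_bias_mode hw0 hmax hf hC hM u, abs_div, abs_mul, abs_of_nonneg hS0,
    abs_of_pos hMpos, mul_div_assoc]
  have hge := geom_sum_mode_ge (q := q) hw0 hmax M (x₀ := x₀)
  have hle1 := geom_sum_mode_le_card (q := q) hw0 hmax M (x₀ := x₀)
  have hle2 := geom_sum_mode_le_weight (q := q) hw0 hmax M (x₀ := x₀)
  refine ⟨mul_le_mul_of_nonneg_left ?_ (abs_nonneg _), mul_le_mul_of_nonneg_left ?_ (abs_nonneg _)⟩
  · rw [le_div_iff₀ hMpos]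
    calc 1 / (1 + M * (w x₀)⁻¹) * M = M / (1 + M * (w x₀)⁻¹) := by ring
      _ ≤ _ := hge
  · rw [div_le_iff₀ hMpos, min_mul_of_nonneg _ _ hMpos.le, one_mul, div_mul_cancel₀ _ hMpos.ne']
    exact le_min hle1 hle2

/-! ## §3 The sign of the bias -/

/-- **An observable extremal at the cold configuration LOOKS SLOWER from the cold start**: if `Var_π f ≤ δ²` then
`E_{x₀} Ĉ_u ≥ γ_u` at every lag `u` and every run length (`r^uδ² − γ_u ≥ r^u(δ² − V) ≥ 0`). [ours] -/
theorem imh_chain_autocovEstimate_bias_nonneg_of_var_le [Fact (Measurable w)] (hw0 : ∀ y, 0 < w y) {x₀ : Ω}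
    (hmax : ∀ y, w y ≤ w x₀) [IsProbabilityMeasure (q.withDensity fun y => ENNReal.ofReal (w y))]
    {f : Ω → ℝ} (hf : Measurable f) {C : ℝ} (hC : ∀ x, |f x| ≤ C) {M : ℕ} (hM : M ≠ 0) (u : ℕ)
    (hvar : ∫ x, (f x - ∫ z, f z ∂(q.withDensity fun y => ENNReal.ofReal (w y))) ^ 2
      ∂(q.withDensity fun y => ENNReal.ofReal (w y)) ≤
      (f x₀ - ∫ z, f z ∂(q.withDensity fun y => ENNReal.ofReal (w y))) ^ 2) :
    autocov (indepMH q w) (q.withDensity fun y => ENNReal.ofReal (w y))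
        (fun x => f x - ∫ z, f z ∂(q.withDensity fun y => ENNReal.ofReal (w y))) u ≤
      (∑ s ∈ Finset.range M, ∫ x, (f (x s) - ∫ z, f z ∂(q.withDensity fun y => ENNReal.ofReal (w y))) *
          (f (x (s + u)) - ∫ z, f z ∂(q.withDensity fun y => ENNReal.ofReal (w y)))
          ∂(Kernel.trajMeasure (X := fun _ : ℕ => Ω) (Measure.dirac x₀)
            (fun n : ℕ => (indepMH q w).comap (fun h : (i : ↥(Finset.Iic n)) → Ω => h ⟨n, Finset.mem_Iic.2 le_rfl⟩)
              (measurable_pi_apply _)))) / M := by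
  have hMpos : (0 : ℝ) < M := by exact_mod_cast Nat.pos_of_ne_zero hM
  have hW : 1 ≤ w x₀ := one_le_of_mode (q := q) hmax
  have hr0 : 0 ≤ 1 - (w x₀)⁻¹ := sub_nonneg.2 (inv_le_one_of_one_le₀ hW)
  have hS0 : 0 ≤ ∑ s ∈ Finset.range M, (1 - (w x₀)⁻¹) ^ s := sum_nonneg fun s _ => pow_nonneg hr0 s
  obtain ⟨-, hγ⟩ := imh_autocov_centred_bounds (q := q) Fact.out hw0 hmax hf hC u (x₀ := x₀)
  have hkey := imh_chain_autocovEstimate_bias_mode hw0 hmax hf hC hM u (x₀ := x₀) (q := q)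
  have hnn : 0 ≤ ((1 - (w x₀)⁻¹) ^ u * (f x₀ - ∫ z, f z ∂(q.withDensity fun y => ENNReal.ofReal (w y))) ^ 2 -
      autocov (indepMH q w) (q.withDensity fun y => ENNReal.ofReal (w y))
        (fun x => f x - ∫ z, f z ∂(q.withDensity fun y => ENNReal.ofReal (w y))) u) *
      (∑ s ∈ Finset.range M, (1 - (w x₀)⁻¹) ^ s) / M := by
    refine div_nonneg (mul_nonneg (sub_nonneg.2 (hγ.trans ?_)) hS0) hMpos.le
    exact mul_le_mul_of_nonneg_left hvar (pow_nonneg hr0 u)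
  linarith [hkey, hnn]

/-- **An observable with `f(x₀) = π f` LOOKS FASTER from the cold start**: `E_{x₀} Ĉ_u = γ_u·(1 − S_M/M) ≤ γ_u` at
every lag (flow-MCMC autocovariances are nonnegative). [ours] -/
theorem imh_chain_autocovEstimate_of_delta_eq_zero [Fact (Measurable w)] (hw0 : ∀ y, 0 < w y) {x₀ : Ω}
    (hmax : ∀ y, w y ≤ w x₀) [IsProbabilityMeasure (q.withDensity fun y => ENNReal.ofReal (w y))]
    {f : Ω → ℝ} (hf : Measurable f) {C : ℝ} (hC : ∀ x, |f x| ≤ C) {M : ℕ} (hM : M ≠ 0) (u : ℕ)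
    (hδ : f x₀ = ∫ z, f z ∂(q.withDensity fun y => ENNReal.ofReal (w y))) :
    (∑ s ∈ Finset.range M, ∫ x, (f (x s) - ∫ z, f z ∂(q.withDensity fun y => ENNReal.ofReal (w y))) *
          (f (x (s + u)) - ∫ z, f z ∂(q.withDensity fun y => ENNReal.ofReal (w y)))
          ∂(Kernel.trajMeasure (X := fun _ : ℕ => Ω) (Measure.dirac x₀)
            (fun n : ℕ => (indepMH q w).comap (fun h : (i : ↥(Finset.Iic n)) → Ω => h ⟨n, Finset.mem_Iic.2 le_rfl⟩)
              (measurable_pi_apply _)))) / M =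
      autocov (indepMH q w) (q.withDensity fun y => ENNReal.ofReal (w y))
          (fun x => f x - ∫ z, f z ∂(q.withDensity fun y => ENNReal.ofReal (w y))) u *
        (1 - (∑ s ∈ Finset.range M, (1 - (w x₀)⁻¹) ^ s) / M) ∧
    (∑ s ∈ Finset.range M, ∫ x, (f (x s) - ∫ z, f z ∂(q.withDensity fun y => ENNReal.ofReal (w y))) *
          (f (x (s + u)) - ∫ z, f z ∂(q.withDensity fun y => ENNReal.ofReal (w y)))
          ∂(Kernel.trajMeasure (X := fun _ : ℕ => Ω) (Measure.dirac x₀)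
            (fun n : ℕ => (indepMH q w).comap (fun h : (i : ↥(Finset.Iic n)) → Ω => h ⟨n, Finset.mem_Iic.2 le_rfl⟩)
              (measurable_pi_apply _)))) / M ≤
      autocov (indepMH q w) (q.withDensity fun y => ENNReal.ofReal (w y))
          (fun x => f x - ∫ z, f z ∂(q.withDensity fun y => ENNReal.ofReal (w y))) u := by
  have hMpos : (0 : ℝ) < M := by exact_mod_cast Nat.pos_of_ne_zero hM
  have hW : 1 ≤ w x₀ := one_le_of_mode (q := q) hmax
  have hr0 : 0 ≤ 1 - (w x₀)⁻¹ := sub_nonneg.2 (inv_le_one_of_one_le₀ hW)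
  have hS0 : 0 ≤ ∑ s ∈ Finset.range M, (1 - (w x₀)⁻¹) ^ s := sum_nonneg fun s _ => pow_nonneg hr0 s
  obtain ⟨hγ0, -⟩ := imh_autocov_centred_bounds (q := q) Fact.out hw0 hmax hf hC u (x₀ := x₀)
  have hkey := imh_chain_autocovEstimate_bias_mode hw0 hmax hf hC hM u (x₀ := x₀) (q := q)
  rw [hδ, sub_self, zero_pow two_ne_zero, mul_zero, zero_sub] at hkey
  have h1 : (∑ s ∈ Finset.range M, ∫ x, (f (x s) - ∫ z, f z ∂(q.withDensity fun y => ENNReal.ofReal (w y))) *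
          (f (x (s + u)) - ∫ z, f z ∂(q.withDensity fun y => ENNReal.ofReal (w y)))
          ∂(Kernel.trajMeasure (X := fun _ : ℕ => Ω) (Measure.dirac x₀)
            (fun n : ℕ => (indepMH q w).comap (fun h : (i : ↥(Finset.Iic n)) → Ω => h ⟨n, Finset.mem_Iic.2 le_rfl⟩)
              (measurable_pi_apply _)))) / M =
      autocov (indepMH q w) (q.withDensity fun y => ENNReal.ofReal (w y))
          (fun x => f x - ∫ z, f z ∂(q.withDensity fun y => ENNReal.ofReal (w y))) u *
        (1 - (∑ s ∈ Finset.range M, (1 - (w x₀)⁻¹) ^ s) / M) := by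
    linear_combination hkey
  refine ⟨h1, ?_⟩
  rw [h1]
  have hfrac : 0 ≤ (∑ s ∈ Finset.range M, (1 - (w x₀)⁻¹) ^ s) / M := div_nonneg hS0 hMpos.le
  nlinarith

/-! ## §4 Lag zero: the measured variance -/

/-- **`E_{x₀}[(1/M)Σ_{s<M} f̄(X_s)²] = V + (δ² − V)·S_M/M`**: the measured variance about the true mean interpolates
between `δ²` (frozen) and `V = Var_π f`, with the burn-in weight `S_M/M`. [ours] -/
theorem imh_chain_varianceEstimate_mode [Fact (Measurable w)] (hw0 : ∀ y, 0 < w y) {x₀ : Ω}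
    (hmax : ∀ y, w y ≤ w x₀) [IsProbabilityMeasure (q.withDensity fun y => ENNReal.ofReal (w y))]
    {f : Ω → ℝ} (hf : Measurable f) {C : ℝ} (hC : ∀ x, |f x| ≤ C) {M : ℕ} (hM : M ≠ 0) :
    (∑ s ∈ Finset.range M, ∫ x, (f (x s) - ∫ z, f z ∂(q.withDensity fun y => ENNReal.ofReal (w y))) ^ 2
        ∂(Kernel.trajMeasure (X := fun _ : ℕ => Ω) (Measure.dirac x₀)
          (fun n : ℕ => (indepMH q w).comap (fun h : (i : ↥(Finset.Iic n)) → Ω => h ⟨n, Finset.mem_Iic.2 le_rfl⟩)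
            (measurable_pi_apply _)))) / M =
      ∫ x, (f x - ∫ z, f z ∂(q.withDensity fun y => ENNReal.ofReal (w y))) ^ 2
          ∂(q.withDensity fun y => ENNReal.ofReal (w y)) +
        ((f x₀ - ∫ z, f z ∂(q.withDensity fun y => ENNReal.ofReal (w y))) ^ 2 -
            ∫ x, (f x - ∫ z, f z ∂(q.withDensity fun y => ENNReal.ofReal (w y))) ^ 2
              ∂(q.withDensity fun y => ENNReal.ofReal (w y))) *
          (∑ s ∈ Finset.range M, (1 - (w x₀)⁻¹) ^ s) / M := by
  have hMpos : (0 : ℝ) < M := by exact_mod_cast Nat.pos_of_ne_zero hM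
  have h := imh_chain_lagProductSum_mode hw0 hmax hf hC M 0 (x₀ := x₀) (q := q)
  rw [pow_zero, one_mul] at h
  have hsq : ∀ s, ∫ x, (f (x s) - ∫ z, f z ∂(q.withDensity fun y => ENNReal.ofReal (w y))) ^ 2
        ∂(Kernel.trajMeasure (X := fun _ : ℕ => Ω) (Measure.dirac x₀)
          (fun n : ℕ => (indepMH q w).comap (fun h : (i : ↥(Finset.Iic n)) → Ω => h ⟨n, Finset.mem_Iic.2 le_rfl⟩)
            (measurable_pi_apply _))) =
      ∫ x, (f (x s) - ∫ z, f z ∂(q.withDensity fun y => ENNReal.ofReal (w y))) *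
        (f (x (s + 0)) - ∫ z, f z ∂(q.withDensity fun y => ENNReal.ofReal (w y)))
        ∂(Kernel.trajMeasure (X := fun _ : ℕ => Ω) (Measure.dirac x₀)
          (fun n : ℕ => (indepMH q w).comap (fun h : (i : ↥(Finset.Iic n)) → Ω => h ⟨n, Finset.mem_Iic.2 le_rfl⟩)
            (measurable_pi_apply _))) := fun s =>
    integral_congr_ae (ae_of_all _ fun x => by simp only [Nat.add_zero, sq])
  have hV : autocov (indepMH q w) (q.withDensity fun y => ENNReal.ofReal (w y))
        (fun x => f x - ∫ z, f z ∂(q.withDensity fun y => ENNReal.ofReal (w y))) 0 =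
      ∫ x, (f x - ∫ z, f z ∂(q.withDensity fun y => ENNReal.ofReal (w y))) ^ 2
        ∂(q.withDensity fun y => ENNReal.ofReal (w y)) := by
    rw [autocov]
    exact integral_congr_ae (ae_of_all _ fun x => by simp only [Function.iterate_zero, id]; rw [sq])
  rw [Finset.sum_congr rfl fun s _ => hsq s, h, hV]
  field_simp

end Summit.Ventures.LatticeQCDFlow.Exactness
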